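import Mathlib.Analysis.Calculus.Deriv.Star
import Literature.NumberTheory.LFunctions.CentralValueForcedZeros
import Literature.NumberTheory.LFunctions.NewformRootNumberPrimeLevel
import Literature.NumberTheory.EllipticCurves.NewformsRealCoefficients
import Literature.NumberTheory.EllipticCurves.NewformsTwistNewCoprimeProofs
import HarnessLib

/-!
# `L(½, f ⊗ χ)` is REAL, and the twisted non-negativity fact reduces to the untwisted one
# (Lapid–Rallis 2003, Thm. 1 / §1 for `n = 2`; Guo 1996; Kohnen–Zagier 1981): proofs

Topic `Literature/NumberTheory/LFunctions` (namespace `Literature.NumberTheory.LFunctions.IwaniecSarnak`,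
companion of `FamilyNonvanishingLandauSiegel`). THEOREMS ONLY (no definition, no named fact; D-0026,
net debt `0`). Cell `landau-siegel`, input I4 / binder `hLR` of the route `PrimeLevelFamEdge`: the named
fact `lapidRallis2003_theorem1_gl2Twist` (`FamilyNonvanishingLandauSiegel`) = Lapid–Rallis 2003, Thm. 1
in the case `n = 2`, vendored for `π = π_f ⊗ χ_D`:
"`∀ f ∈ H_k(N)`, `χ` real primitive mod `D`, `(N, D) = 1`: `im L(½, f ⊗ χ) = 0 ∧ 0 ≤ re L(½, f ⊗ χ)`".
This file PROVES what the tree's classical vocabulary reaches and isolates exactly what it does not: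

1. **Realness, proved** (`twistedCentralValue_im_eq_zero_of_isQuadratic`, `centralValue_im_eq_zero_of_newform`, and at every
   real point `entireLSeries_ofReal_im_eq_zero`): the printed clause "Suppose that `π` is self-dual.
   Then the standard `L`-function `L(s, π)` is real for `s ∈ ℝ`" [LapidRallis2003, §1 p. 891] for
   `π = π_f ⊗ χ`, `f` a newform on `Γ₀(N)` (trivial nebentypus) and `χ` quadratic — with NO
   primitivity or coprimality hypothesis. Mechanism: the Dirichlet coefficients `χ(n) aₙ(f)` are real
   (`IsNewform0.conj_cuspCoeff`: newforms on `Γ₀(N)` have real Fourier coefficients, Shimura 1971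
   proof of Thm. 3.48; `χ(n) ∈ {0, ±1}`), so `\overline{L(s)} = L(s̄)` on the half-plane of convergence
   (`conj_LSeries`), and the Schwarz reflection `s ↦ \overline{g(s̄)}` of the entire continuation `g` is
   again an entire continuation (Mathlib `DifferentiableAt.conj_conj`), hence equal to `g` by uniqueness
   (`subsingleton_LSeriesContinuations`): `\overline{g(s)} = g(s̄)` (`conj_entireLSeries`; both branches
   of `entireLSeries`, the junk branch being the `L`-series itself). ALL weights `k`; the weight-`2`
   case via the integral representation is the sibling `IwaniecSarnakMixedCentralValueAFE`
   (`centralValue_im_eq_zero_of_mem_newforms0`, `twistedCentralValue_im_eq_zero_of_mem_newforms0`).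
2. **The reduction, proved** (`lapidRallis2003_theorem1_gl2Twist_iff_centralValue_nonneg`): the fact is
   EQUIVALENT to its untwisted slice at all levels,
   `∀ N k, ∀ f ∈ H_k(N): 0 ≤ re L(½, f)` — i.e. to "`L(½, π) ≥ 0` for the `π = π_f` of holomorphic
   newforms with trivial central character" (Guo 1996, Thm.; at level `1` Kohnen–Zagier 1981, Cor. 1;
   Waldspurger 1981) — because for `(N, D) = 1` the twist `f_χ = ∑ χ(n) aₙ(f) qⁿ` IS a newform of level
   `N D²` with trivial character (Atkin–Li 1978, Thm. 3.1; tree theorem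
   `isNewform0_charTwist_of_coprime`, all conductors) whose central value is `L(½, f ⊗ χ)`
   (tree theorem `twistedCentralValue_eq_centralValue_charTwist`, `CentralValueForcedZeros`). So the
   twist adds nothing: the whole content of the fact is the sign of `L(½, f)` for newforms
   `f ∈ S_k(Γ₀(M))`, all `M` — and only for those of root number `w_f ≠ −1` (i.e. `w_f = +1`), the
   odd ones having `L(½, f) = 0` (tree theorem `centralValue_eq_zero_of_rootNumber`):
   `lapidRallis2003_theorem1_gl2Twist_iff_centralValue_nonneg_of_rootNumber_ne` /
   `…_of_rootNumber_eq_one` (every newform on `Γ₀(N)` has even weight, `even_of_mem_newforms0`, and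
   `w_f = ±1`, `rootNumber_eq_one_or_neg_one_of_mem`).
3. **What is NOT proved, and why** (no claim): the sign `0 ≤ re L(½, f)`. Every printed proof goes
   through an identity exhibiting `L(½, f)` (times a positive constant) as a SQUARE or a positive
   semi-definite quantity — Waldspurger 1981 / Kohnen–Zagier 1981 Thm. 1 (`c(|D|)²/⟨g,g⟩ =
   ((k−1)!/π^k)|D|^{k−½} L(f,D,k)/⟨f,f⟩` with `g` the weight-`k+½` Shimura correspondent of `f`),
   Baruch–Mao 2007 (all `D`, squarefree odd level), Guo 1996 (Jacquet's relative trace formula),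
   Lapid–Rallis 2003 (residues of Siegel Eisenstein series on `Sp_n`) — and none of half-integral
   weight forms, the Shimura–Waldspurger correspondence, the relative trace formula or Eisenstein
   series on `Sp_n` exists in Mathlib or the tree. The untwisted slice is NOT minted as a new named
   fact (it is a corollary of the existing one, `centralValue_nonneg`); it appears only as the
   right-hand side of the proved equivalence.

## References

* [LapidRallis2003] E. Lapid, S. Rallis, *On the nonnegativity of `L(½, π)` for `SO_{2n+1}`*, Ann. of
  Math. 157 (2003) 891–917, Thm. 1 and §1 p. 891 [held text `paper:arxiv-math_0402371` p0002:L3–L5: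
  "Suppose that `π` is self-dual. Then … `L(s, π)` is real for `s ∈ ℝ` …"; "Theorem 1. Let `π` be a
  symplectic cuspidal representation of `GL_n(𝔸)`. Then `L(½, π) ≥ 0`"; "In the case `n = 2`, `π` is
  symplectic exactly when the central character of `π` is trivial … ([KZ81], [KS93] … [Guo96] …)"].
* [Guo1996] J. Guo, *On the positivity of the central critical values of automorphic `L`-functions
  for `GL(2)`*, Duke Math. J. 83 (1996) 157–190 (not held).
* [KohnenZagier1981] W. Kohnen, D. Zagier, *Values of `L`-series of modular forms at the center of the
  critical strip*, Invent. Math. 64 (1981) 175–198, Thm. 1, Cor. 1 (not held).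
* [Waldspurger1981] J.-L. Waldspurger, *Sur les coefficients de Fourier des formes modulaires de poids
  demi-entier*, J. Math. Pures Appl. 60 (1981) 375–484 [restated: held `paper:arxiv-1208.4329`
  p0009:L90 Thm. 7, p0010 Cor. 5.2].
* [IwaniecConversations2006] H. Iwaniec, *Conversations on the exceptional character*, LNM 1891
  (2006), §7 p. 96: "the central values `L(½,f)`, `L(½,f_χ)` are known unconditionally to be
  non-negative … (see Waldspurger [Wa], Kohnen–Zagier [KZ], Katok–Sarnak [KS], Guo [Gu])".
* [AtkinLi1978] A. O. L. Atkin, W.-C. W. Li, Invent. Math. 48 (1978), §3 Thm. 3.1 (the twist is a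
  newform of level `N D²`).
* [Shimura1971] G. Shimura, *Introduction to the arithmetic theory of automorphic functions*, proof of
  Thm. 3.48 (real coefficients), Prop. 3.64 (twists).
* [DiamondShurman2005] F. Diamond, J. Shurman, *A first course in modular forms*, GTM 228, §4.3 p. 119
  (no odd weight on `Γ₀(N)`); [Knapp1993] A. W. Knapp, *Elliptic curves*, Thm. 9.27 (`ε = ±1`).
-/

noncomputable section

open scoped MatrixGroups ComplexConjugate Topology

open CongruenceSubgroup Filter
open Literature.NumberTheory.EllipticCurves.ModularForms

namespace Literature.NumberTheory.LFunctions

namespace IwaniecSarnak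

/-! ### Step 1. Complex conjugation, `L`-series with real coefficients, Schwarz reflection -/

section Conj

/-- `\overline{L(a, s)} = L(ā, s̄)`: complex conjugation of an `L`-series (termwise; in the
non-summable case both sides are the junk value `0` together). [folklore] -/
private theorem conj_LSeries (a : ℕ → ℂ) (s : ℂ) :
    conj (LSeries a s) = LSeries (fun n ↦ conj (a n)) (conj s) := by
  rw [LSeries, LSeries, Complex.conj_tsum]
  refine tsum_congr fun n ↦ ?_
  rcases eq_or_ne n 0 with rfl | hn
  · simp [LSeries.term_zero]
  · have harg : (n : ℂ).arg ≠ Real.pi := by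
      rw [Complex.natCast_arg]; exact Real.pi_pos.ne
    rw [LSeries.term_of_ne_zero hn, LSeries.term_of_ne_zero hn, map_div₀,
      Complex.cpow_conj _ _ harg, Complex.conj_natCast]

/-- For REAL coefficients, `\overline{L(a, s)} = L(a, s̄)`. [folklore] -/
private theorem conj_LSeries_of_real {a : ℕ → ℂ} (ha : ∀ n, conj (a n) = a n) (s : ℂ) :
    conj (LSeries a s) = LSeries a (conj s) := by
  rw [conj_LSeries]
  exact LSeries_congr (fun {n} _ ↦ ha n) _

/-- The Schwarz reflection `w ↦ \overline{g(w̄)}` of an entire function is entire (Mathlib's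
`DifferentiableAt.conj_conj`, pointwise). [folklore] -/
private theorem differentiable_conj_conj {g : ℂ → ℂ} (hg : Differentiable ℂ g) :
    Differentiable ℂ (fun w ↦ conj (g (conj w))) := fun z ↦ by
  have h := (hg (conj z)).conj_conj
  rw [Complex.conj_conj] at h
  exact h

/-- For real coefficients, the reflection of an entire continuation of `L(a, s)` is again an
entire continuation. [folklore] -/
private theorem conj_conj_mem_LSeriesContinuations {a : ℕ → ℂ} (ha : ∀ n, conj (a n) = a n)
    {σ₀ : ℝ} {g : ℂ → ℂ} (hg : g ∈ LSeriesContinuations a σ₀) :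
    (fun w ↦ conj (g (conj w))) ∈ LSeriesContinuations a σ₀ := by
  refine ⟨differentiable_conj_conj hg.1, fun s hs ↦ ?_⟩
  have hs' : σ₀ < (conj s).re := by rwa [Complex.conj_re]
  show conj (g (conj s)) = LSeries a s
  rw [hg.2 _ hs', conj_LSeries_of_real ha, Complex.conj_conj]

/-- **`\overline{L(s)} = L(s̄)` for the entire `L`-function of a REAL coefficient sequence**
(`entireLSeries`; by uniqueness of the entire continuation — Schwarz reflection — when a
continuation exists, and termwise for the junk branch `LSeries a`). This is "`L(s, π)` is real for
`s ∈ ℝ`" for self-dual `π` [Lapid–Rallis 2003, §1 p. 891], at the level of Dirichlet series with real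
coefficients. [cite: LapidRallis2003, §1 p. 891] -/
theorem conj_entireLSeries {a : ℕ → ℂ} (ha : ∀ n, conj (a n) = a n) (σ₀ : ℝ) (s : ℂ) :
    conj (entireLSeries a σ₀ s) = entireLSeries a σ₀ (conj s) := by
  by_cases h : (LSeriesContinuations a σ₀).Nonempty
  · obtain ⟨g, hg⟩ := h
    have hh := conj_conj_mem_LSeriesContinuations ha hg
    have heq : g = fun w ↦ conj (g (conj w)) := subsingleton_LSeriesContinuations a σ₀ hg hh
    rw [entireLSeries_eq_of_mem hg]
    have h1 := congrFun heq (conj s)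
    rw [Complex.conj_conj] at h1
    exact h1.symm
  · have hjunk : entireLSeries a σ₀ = LSeries a := by
      unfold entireLSeries
      rw [dif_neg h]
    rw [hjunk, conj_LSeries_of_real ha]

/-- **The entire `L`-function of a real coefficient sequence is real at real points** (`conj s = s`).
[cite: LapidRallis2003, §1 p. 891] -/
theorem entireLSeries_im_eq_zero_of_real {a : ℕ → ℂ} (ha : ∀ n, conj (a n) = a n) (σ₀ : ℝ)
    {s : ℂ} (hs : conj s = s) : (entireLSeries a σ₀ s).im = 0 := by
  rw [← Complex.conj_eq_iff_im, conj_entireLSeries ha, hs]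

end Conj

/-! ### Step 2. Realness of `L(½, f ⊗ χ)` and `L(½, f)` for newforms on `Γ₀(N)` -/

section Real

variable {N : ℕ} [NeZero N] {k : ℤ}

/-- The Dirichlet coefficients `χ(n) aₙ(f)` of `L(f ⊗ χ, s)` are real for a newform `f` on `Γ₀(N)`
(`IsNewform0.conj_cuspCoeff`, Shimura 1971, proof of Thm. 3.48) and a quadratic `χ`
(`χ(n) ∈ {0, 1, −1}`). [cite: Shimura1971, proof of Thm. 3.48] -/
theorem conj_twistCoeff {f : CuspForm (Gamma0 N) k} (hf : f ∈ newforms0 N k) {D : ℕ}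
    (χ : DirichletCharacter ℂ D) (hq : χ.IsQuadratic) (n : ℕ) :
    conj (χ n * cuspCoeff f n) = χ n * cuspCoeff f n := by
  rw [map_mul, IsNewform0.conj_cuspCoeff hf n]
  congr 1
  rcases hq (n : ZMod D) with h | h | h <;> simp [h]

/-- **`L(s, f ⊗ χ)` is real on the real axis** (the entire continuation, at every real `s`), for a
newform `f ∈ H_k(N)` and a quadratic character `χ` — no primitivity or coprimality needed: "`L(s, π)`
is real for `s ∈ ℝ`" for the self-dual `π = π_f ⊗ χ`. [cite: LapidRallis2003, §1 p. 891] -/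
theorem entireLSeries_ofReal_im_eq_zero {f : CuspForm (Gamma0 N) k} (hf : f ∈ newforms0 N k)
    {D : ℕ} (χ : DirichletCharacter ℂ D) (hq : χ.IsQuadratic) (s : ℝ) :
    (entireLSeries (fun n ↦ χ n * cuspCoeff f n) ((k : ℝ) / 2 + 1) s).im = 0 :=
  entireLSeries_im_eq_zero_of_real (fun n ↦ conj_twistCoeff hf χ hq n) _ (Complex.conj_ofReal s)

/-- **`L(½, f ⊗ χ)` is real**: `im (twistedCentralValue f χ) = 0` for every newform `f ∈ H_k(N)` and
every quadratic Dirichlet character `χ` — the first conjunct of `lapidRallis2003_theorem1_gl2Twist`,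
PROVED unconditionally and without its primitivity/coprimality hypotheses.
[cite: LapidRallis2003, §1 p. 891] -/
theorem twistedCentralValue_im_eq_zero_of_isQuadratic {f : CuspForm (Gamma0 N) k} (hf : f ∈ newforms0 N k)
    {D : ℕ} (χ : DirichletCharacter ℂ D) (hq : χ.IsQuadratic) :
    (twistedCentralValue f χ).im = 0 := by
  unfold twistedCentralValue
  refine entireLSeries_im_eq_zero_of_real (fun n ↦ conj_twistCoeff hf χ hq n) _ ?_
  rw [map_div₀, map_intCast, map_ofNat]

/-- **`L(½, f)` is real**: `im (centralValue f) = 0` for every newform `f ∈ H_k(N)`.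
[cite: LapidRallis2003, §1 p. 891] -/
theorem centralValue_im_eq_zero_of_newform {f : CuspForm (Gamma0 N) k} (hf : f ∈ newforms0 N k) :
    (centralValue f).im = 0 := by
  unfold centralValue
  refine entireLSeries_im_eq_zero_of_real (fun n ↦ IsNewform0.conj_cuspCoeff hf n) _ ?_
  rw [map_div₀, map_intCast, map_ofNat]

end Real

/-! ### Step 3. The twisted fact is its untwisted slice -/

section Reduction

variable {N : ℕ} [NeZero N] {k : ℤ}

/-- **Lapid–Rallis Thm. 1 (`n = 2`, twisted form) ⟺ its untwisted slice.** The named fact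
`lapidRallis2003_theorem1_gl2Twist` ("`L(½, f ⊗ χ_D)` real and `≥ 0` for `f ∈ H_k(N)`, `χ_D` real
primitive, `(N, D) = 1`") is EQUIVALENT to "`0 ≤ re L(½, f)` for every newform `f ∈ H_k(N)`, every
`N`, `k`" — Guo 1996 / Kohnen–Zagier 1981 Cor. 1 / Waldspurger for `π_f` itself. (`→`: `D = 1`,
`centralValue_nonneg`. `←`: realness is `twistedCentralValue_im_eq_zero_of_isQuadratic`; for the sign, `f_χ` is a
newform of level `N D²` (Atkin–Li, `isNewform0_charTwist_of_coprime`) with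
`L(½, f ⊗ χ) = L(½, f_χ)`.) The right-hand side is NOT asserted here.
[cite: LapidRallis2003, Thm. 1 (case n = 2)] -/
theorem lapidRallis2003_theorem1_gl2Twist_iff_centralValue_nonneg :
    lapidRallis2003_theorem1_gl2Twist ↔
      ∀ (N : ℕ) [NeZero N] (k : ℤ) (f : CuspForm (Gamma0 N) k), f ∈ newforms0 N k →
        0 ≤ (centralValue f).re := by
  constructor
  · intro h N _ k f hf
    exact (centralValue_nonneg h hf).2
  · intro h N _ k f hf D _ χ hprim hq hND
    refine ⟨twistedCentralValue_im_eq_zero_of_isQuadratic hf χ hq, ?_⟩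
    rw [twistedCentralValue_eq_centralValue_charTwist (dvd_mul_right N (D ^ 2))
      (dvd_mul_left (D ^ 2) N) hq hprim f]
    exact h (N * D ^ 2) k _ (charTwist_mem_newforms0_of_coprime hq hprim hND hf)

/-- **… and it is its untwisted slice on the forms of root number `≠ −1` only.** Newforms with
`w_f = −1` have `L(½, f) = 0` by the functional equation (tree theorem
`centralValue_eq_zero_of_rootNumber`, Iwaniec 2006 §4 (4.5)), so the fact is equivalent to
"`0 ≤ re L(½, f)` for every newform `f ∈ H_k(N)` with `w_f ≠ −1`" (for the even weights where
newforms exist, `w_f = i^k ε_Fricke(f) ∈ {±1}`, i.e. the EVEN forms `w_f = +1`): exactly the case the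
printed proofs treat by exhibiting `L(½, f)` as a square (Waldspurger / Kohnen–Zagier) or a positive
semi-definite residue pairing (Lapid–Rallis). The right-hand side is NOT asserted here.
[cite: LapidRallis2003, Thm. 1 (case n = 2)] -/
theorem lapidRallis2003_theorem1_gl2Twist_iff_centralValue_nonneg_of_rootNumber_ne :
    lapidRallis2003_theorem1_gl2Twist ↔
      ∀ (N : ℕ) [NeZero N] (k : ℤ) (f : CuspForm (Gamma0 N) k), f ∈ newforms0 N k →
        rootNumber f ≠ -1 → 0 ≤ (centralValue f).re := by
  rw [lapidRallis2003_theorem1_gl2Twist_iff_centralValue_nonneg]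
  constructor
  · intro h N _ k f hf _
    exact h N k f hf
  · intro h N _ k f hf
    by_cases hw : rootNumber f = -1
    · rw [centralValue_eq_zero_of_rootNumber hf hw, Complex.zero_re]
    · exact h N k f hf hw

/-- Newforms on `Γ₀(N)` have EVEN weight: `−1 ∈ Γ₀(N)` kills odd weights (tree
`eq_zero_of_odd_weight_gamma0`, Diamond–Shurman §4.3), while a newform has `a₁ = 1 ≠ 0`.
[cite: DiamondShurman2005, §4.3 p. 119] -/
theorem even_of_mem_newforms0 {f : CuspForm (Gamma0 N) k} (hf : f ∈ newforms0 N k) : Even k := by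
  rcases Int.even_or_odd k with hk | hk
  · exact hk
  · exfalso
    have h1 : cuspCoeff f 1 = 1 := hf.2.2
    rw [eq_zero_of_odd_weight_gamma0 N hk f, cuspCoeff_zero_form (one_mem_strictPeriods_gamma0 N)] at h1
    exact zero_ne_one h1

/-- `w_f = ±1` for EVERY newform on `Γ₀(N)` (the tree's `rootNumber_eq_one_or_neg_one` with its
evenness hypothesis discharged by `even_of_mem_newforms0`). [cite: Knapp1993, Thm. 9.27] -/
theorem rootNumber_eq_one_or_neg_one_of_mem {f : CuspForm (Gamma0 N) k} (hf : f ∈ newforms0 N k) :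
    rootNumber f = 1 ∨ rootNumber f = -1 :=
  rootNumber_eq_one_or_neg_one (even_of_mem_newforms0 hf) hf

/-- **The fact is its untwisted slice on the EVEN forms (`w_f = +1`).** Equivalent form of the
previous theorem, since `w_f ∈ {±1}` for every newform (`rootNumber_eq_one_or_neg_one_of_mem`):
`lapidRallis2003_theorem1_gl2Twist ⟺ ∀ N k, ∀ f ∈ H_k(N) with w_f = 1: 0 ≤ re L(½, f)`. This is the
precise remaining content — "`L(½, f) ≥ 0` for even newforms with trivial character" (Kohnen–Zagier
1981 Cor. 1 at level `1`; Waldspurger 1981; Guo 1996) — and it is NOT asserted here.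
[cite: LapidRallis2003, Thm. 1 (case n = 2)] -/
theorem lapidRallis2003_theorem1_gl2Twist_iff_centralValue_nonneg_of_rootNumber_eq_one :
    lapidRallis2003_theorem1_gl2Twist ↔
      ∀ (N : ℕ) [NeZero N] (k : ℤ) (f : CuspForm (Gamma0 N) k), f ∈ newforms0 N k →
        rootNumber f = 1 → 0 ≤ (centralValue f).re := by
  rw [lapidRallis2003_theorem1_gl2Twist_iff_centralValue_nonneg_of_rootNumber_ne]
  constructor
  · intro h N _ k f hf hw
    exact h N k f hf (by rw [hw]; norm_num)
  · intro h N _ k f hf hw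
    rcases rootNumber_eq_one_or_neg_one_of_mem hf with h1 | h1
    · exact h N k f hf h1
    · exact absurd h1 hw

/-- The fact is also equivalent to its SIGN conjunct alone (realness being proved).
[cite: LapidRallis2003, Thm. 1 (case n = 2)] -/
theorem lapidRallis2003_theorem1_gl2Twist_iff_re_nonneg :
    lapidRallis2003_theorem1_gl2Twist ↔
      ∀ (N : ℕ) [NeZero N] (k : ℤ) (f : CuspForm (Gamma0 N) k), f ∈ newforms0 N k →
        ∀ (D : ℕ) [NeZero D] (χ : DirichletCharacter ℂ D), χ.IsPrimitive → χ.IsQuadratic →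
          N.Coprime D → 0 ≤ (twistedCentralValue f χ).re := by
  constructor
  · intro h N _ k f hf D _ χ hprim hq hND
    exact (h N k f hf D χ hprim hq hND).2
  · intro h N _ k f hf D _ χ hprim hq hND
    exact ⟨twistedCentralValue_im_eq_zero_of_isQuadratic hf χ hq, h N k f hf D χ hprim hq hND⟩

/-- **Untwisted non-negativity ⇒ the fact** (the direction a future proof of "`L(½, f) ≥ 0` for
newforms" — Guo / Kohnen–Zagier / Waldspurger — would use to discharge
`lapidRallis2003_theorem1_gl2Twist`). [cite: LapidRallis2003, Thm. 1 (case n = 2)] -/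
theorem lapidRallis2003_theorem1_gl2Twist_of_centralValue_nonneg
    (h : ∀ (N : ℕ) [NeZero N] (k : ℤ) (f : CuspForm (Gamma0 N) k), f ∈ newforms0 N k →
      0 ≤ (centralValue f).re) :
    lapidRallis2003_theorem1_gl2Twist :=
  lapidRallis2003_theorem1_gl2Twist_iff_centralValue_nonneg.mpr h

end Reduction

end IwaniecSarnak

end Literature.NumberTheory.LFunctions

end
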